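import Summits.KontsevichZagierPeriods.Zeta5Search.Certificates.RecordRayGrowth
import HarnessLib

/-!
# ζ(5) search — certificates: the growth of `Q(a·n)` on the record ray, PROVED without a recurrence — II: upper bound and rates

HONEST FRAMING: systematic search; no irrationality claim unless certified.

OUR work (Summit side; certifier 2). Continuation of `Certificates/RecordRayGrowth.lean` (see its docstring for the
whole statement list and the method). Here:

* the rational slopes `t₁,…,t₇` (`t₅`, `t₇` SOLVED from the two stationarity relations `slope_rel₁`, `slope_rel₂`,
  so that the Chernoff exponent does not depend on `(k₁,k₂)`), `growthSup = A₀`, `qTerm_record_le`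
  (every term `≤ exp(n·A₀)`), `abs_recordQ_le` (`|Q(a·n)| ≤ (15n+1)(8n+1)·exp(n·A₀)` for EVERY `n`),
  `growthSup_le` (`A₀ ≤ 85.08768884`, certified logarithms);
* the rates `eventually_abs_recordQ_le_exp` / `eventually_exp_le_abs_recordQ`
  (`e^{(85.0519−ε)n} ≤ |Q(a·n)| ≤ e^{(85.08768884+ε)n}` for large `n`);
* `rate_mem_of_tendsto` — ANY limit of `log|Q(a·n)|/n` lies in `[85.0519, 85.08768884]` (no hypothesis), hence
  `record_rates_Q_upper`: the limit asserted by the FACT `BrownZudilin2022.record_rates` obeys the printed upper bracket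
  `≤ 85.08768884` as a THEOREM about the actual sequence (the fact prints `85.08768883…`; true sup `85.0876888342…`,
  `A₀ = 85.0876888366…`).
-/

noncomputable section

open Finset Real Filter Topology

namespace Summit.KontsevichZagierPeriods.Zeta5Search.RecordRay

open Summit.KontsevichZagierPeriods.Zeta5Search.BinomialSum
open Summit.KontsevichZagierPeriods.Zeta5Search.LogEnclosures
open Literature.NumberTheory.Irrationality.BrownZudilin2022 (zchoose Qcoeff QOf pOf qOf recordVec)

/-! ### Upper bound: the Chernoff bound at fixed rational slopes -/

/-- Slope for `C(k₁, 15n)`: `t₁ ≈ 15/x* = 0.62164…`. -/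
def t₁ : ℝ := 12433 / 20000
/-- Slope for `C(k₂, 12n)`: `t₂ ≈ 12/y* = 0.51603…`. -/
def t₂ : ℝ := 12901 / 25000
/-- Slope for `C(k₁+k₂−17n, 12n)`: `t₃ ≈ 12/(x*+y*−17) = 0.39494…`. -/
def t₃ : ℝ := 7899 / 20000
/-- Slope for `C(15n, k₁−14n)`: `t₄ ≈ (x*−14)/15 = 0.67529…`. -/
def t₄ : ℝ := 6753 / 10000
/-- Slope for `C(12n, k₁−16n)`, SOLVED from the first stationarity relation (`slope_rel₁`):
`t₅ = 1/(1+R₁)`, `R₁ = (1−t₁)(1−t₃)t₄/(1−t₄)`; `≈ (x*−16)/12 = 0.67745…`. -/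
def t₅ : ℝ := 1298800000000 / 1917160507051
/-- Slope for `C(8n, k₂−18n)`: `t₆ ≈ (y*−18)/8 = 0.65677…`. -/
def t₆ : ℝ := 32839 / 50000
/-- Slope for `C(16n, k₂−13n)`, SOLVED from the second stationarity relation (`slope_rel₂`); `≈ (y*−13)/16 = 0.64088…`. -/
def t₇ : ℝ := 8580500000000 / 13388457957161

/-- All slopes lie in `(0,1)`. -/
theorem slopes_mem : (0 < t₁ ∧ t₁ < 1) ∧ (0 < t₂ ∧ t₂ < 1) ∧ (0 < t₃ ∧ t₃ < 1) ∧ (0 < t₄ ∧ t₄ < 1) ∧ (0 < t₅ ∧ t₅ < 1)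
    ∧ (0 < t₆ ∧ t₆ < 1) ∧ (0 < t₇ ∧ t₇ < 1) := by
  unfold t₁ t₂ t₃ t₄ t₅ t₆ t₇; norm_num

/-- The `n`-coefficient of the Chernoff exponent: `A₀ = Σ_i [k_i⁰·(−log t_i) + (m_i⁰ − k_i⁰)·(−log(1−t_i))]` at `n = 1`
(`= 85.0876888366…`, within `2.4·10⁻⁹` of the supremum `85.0876888342…` of the entropy). -/
def growthSup : ℝ :=
  15 * (-Real.log t₁) - 15 * (-Real.log (1 - t₁)) + 12 * (-Real.log t₂) - 12 * (-Real.log (1 - t₂))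
  + 12 * (-Real.log t₃) - 29 * (-Real.log (1 - t₃)) - 14 * (-Real.log t₄) + 29 * (-Real.log (1 - t₄))
  - 16 * (-Real.log t₅) + 28 * (-Real.log (1 - t₅)) - 18 * (-Real.log t₆) + 26 * (-Real.log (1 - t₆))
  - 13 * (-Real.log t₇) + 29 * (-Real.log (1 - t₇))

/-- **First stationarity relation** (the `k₁`-coefficient of the exponent vanishes):
`(1−t₄)(1−t₅) = (1−t₁)(1−t₃)t₄t₅`, in logarithms. -/
theorem slope_rel₁ :
    -Real.log (1 - t₁) - Real.log (1 - t₃) - Real.log t₄ + Real.log (1 - t₄) - Real.log t₅ + Real.log (1 - t₅) = 0 := by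
  have key : Real.log ((1 - t₄) * (1 - t₅)) = Real.log ((1 - t₁) * (1 - t₃) * t₄ * t₅) := by
    congr 1; unfold t₁ t₃ t₄ t₅; norm_num
  have h1 : (1 : ℝ) - t₁ ≠ 0 := by unfold t₁; norm_num
  have h3 : (1 : ℝ) - t₃ ≠ 0 := by unfold t₃; norm_num
  have h4 : t₄ ≠ 0 := by unfold t₄; norm_num
  have h4' : (1 : ℝ) - t₄ ≠ 0 := by unfold t₄; norm_num
  have h5 : t₅ ≠ 0 := by unfold t₅; norm_num
  have h5' : (1 : ℝ) - t₅ ≠ 0 := by unfold t₅; norm_num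
  rw [Real.log_mul h4' h5', Real.log_mul (by positivity) h5, Real.log_mul (by positivity) h4,
    Real.log_mul h1 h3] at key
  linarith

/-- **Second stationarity relation** (the `k₂`-coefficient vanishes): `(1−t₆)(1−t₇) = (1−t₂)(1−t₃)t₆t₇`. -/
theorem slope_rel₂ :
    -Real.log (1 - t₂) - Real.log (1 - t₃) - Real.log t₆ + Real.log (1 - t₆) - Real.log t₇ + Real.log (1 - t₇) = 0 := by
  have key : Real.log ((1 - t₆) * (1 - t₇)) = Real.log ((1 - t₂) * (1 - t₃) * t₆ * t₇) := by
    congr 1; unfold t₂ t₃ t₆ t₇; norm_num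
  have h2 : (1 : ℝ) - t₂ ≠ 0 := by unfold t₂; norm_num
  have h3 : (1 : ℝ) - t₃ ≠ 0 := by unfold t₃; norm_num
  have h6 : t₆ ≠ 0 := by unfold t₆; norm_num
  have h6' : (1 : ℝ) - t₆ ≠ 0 := by unfold t₆; norm_num
  have h7 : t₇ ≠ 0 := by unfold t₇; norm_num
  have h7' : (1 : ℝ) - t₇ ≠ 0 := by unfold t₇; norm_num
  rw [Real.log_mul h6' h7', Real.log_mul (by positivity) h7, Real.log_mul (by positivity) h6,
    Real.log_mul h2 h3] at key
  linarith

/-- **Every term of (17) on the ray is `≤ exp(n·A₀)`** (Chernoff bound; the `(k₁,k₂)`-dependence cancels by the two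
stationarity relations). -/
theorem qTerm_record_le (n : ℕ) (k₁ k₂ : ℤ) :
    (qTerm (pRec n) (qRec n) k₁ k₂ : ℝ) ≤ Real.exp ((n : ℝ) * growthSup) := by
  obtain ⟨h₁, h₂, h₃, h₄, h₅, h₆, h₇⟩ := slopes_mem
  have h := qTerm_le_exp (pRec n) (qRec n) k₁ k₂ h₁ h₂ h₃ h₄ h₅ h₆ h₇
  simp only [pRec_0, pRec_1, pRec_2, pRec_3, pRec_4, pRec_5, pRec_6, qRec_0, qRec_1, qRec_2, qRec_3, qRec_4] at h
  push_cast at h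
  refine h.trans (le_of_eq ?_)
  congr 1
  unfold growthSup
  linear_combination ((k₁ : ℝ)) * slope_rel₁ + ((k₂ : ℝ)) * slope_rel₂

/-- **Upper bound for every `n`**: `|Q(a·n)| ≤ (15n+1)(8n+1)·exp(n·A₀)`. -/
theorem abs_recordQ_le (n : ℕ) :
    |(recordQ n : ℝ)| ≤ (15 * (n : ℝ) + 1) * (8 * (n : ℝ) + 1) * Real.exp ((n : ℝ) * growthSup) := by
  rw [recordQ_eq_Qcoeff]
  have h := abs_Qcoeff_le_of_forall (pRec n) (qRec n) (by rw [qRec_0]; positivity) (by rw [qRec_3]; positivity)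
    (B := Real.exp ((n : ℝ) * growthSup)) (fun k₁ _ k₂ _ => qTerm_record_le n k₁ k₂)
  simp only [qRec_0, qRec_3] at h
  push_cast at h
  exact h

/-- **`A₀ ≤ 85.08768884`** (certified logarithms; the printed rate is `85.08768883…`). -/
theorem growthSup_le : growthSup ≤ 8508768884 / 10 ^ 8 := by
  have l1 : Real.log t₁ = Real.log 12433 - Real.log 20000 := by
    unfold t₁; exact Real.log_div (by norm_num) (by norm_num)
  have l1' : Real.log (1 - t₁) = Real.log 7567 - Real.log 20000 := by
    unfold t₁; rw [show (1 : ℝ) - 12433 / 20000 = 7567 / 20000 by norm_num]; exact Real.log_div (by norm_num) (by norm_num)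
  have l2 : Real.log t₂ = Real.log 12901 - Real.log 25000 := by
    unfold t₂; exact Real.log_div (by norm_num) (by norm_num)
  have l2' : Real.log (1 - t₂) = Real.log 12099 - Real.log 25000 := by
    unfold t₂; rw [show (1 : ℝ) - 12901 / 25000 = 12099 / 25000 by norm_num]; exact Real.log_div (by norm_num) (by norm_num)
  have l3 : Real.log t₃ = Real.log 7899 - Real.log 20000 := by
    unfold t₃; exact Real.log_div (by norm_num) (by norm_num)
  have l3' : Real.log (1 - t₃) = Real.log 12101 - Real.log 20000 := by
    unfold t₃; rw [show (1 : ℝ) - 7899 / 20000 = 12101 / 20000 by norm_num]; exact Real.log_div (by norm_num) (by norm_num)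
  have l4 : Real.log t₄ = Real.log 6753 - Real.log 10000 := by
    unfold t₄; exact Real.log_div (by norm_num) (by norm_num)
  have l4' : Real.log (1 - t₄) = Real.log 3247 - Real.log 10000 := by
    unfold t₄; rw [show (1 : ℝ) - 6753 / 10000 = 3247 / 10000 by norm_num]; exact Real.log_div (by norm_num) (by norm_num)
  have l5 : Real.log t₅ = 2 * Real.log 20000 + Real.log 3247 - Real.log 1917160507051 := by
    unfold t₅
    rw [Real.log_div (by norm_num) (by norm_num), show (1298800000000 : ℝ) = 20000 ^ 2 * 3247 by norm_num,
      Real.log_mul (by norm_num) (by norm_num), Real.log_pow]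
    push_cast; ring
  have l5' : Real.log (1 - t₅) = Real.log 7567 + Real.log 12101 + Real.log 6753 - Real.log 1917160507051 := by
    unfold t₅
    rw [show (1 : ℝ) - 1298800000000 / 1917160507051 = 7567 * 12101 * 6753 / 1917160507051 by norm_num,
      Real.log_div (by norm_num) (by norm_num), Real.log_mul (by norm_num) (by norm_num),
      Real.log_mul (by norm_num) (by norm_num)]
  have l6 : Real.log t₆ = Real.log 32839 - Real.log 50000 := by
    unfold t₆; exact Real.log_div (by norm_num) (by norm_num)
  have l6' : Real.log (1 - t₆) = Real.log 17161 - Real.log 50000 := by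
    unfold t₆; rw [show (1 : ℝ) - 32839 / 50000 = 17161 / 50000 by norm_num]; exact Real.log_div (by norm_num) (by norm_num)
  have l7 : Real.log t₇ = Real.log 25000 + Real.log 20000 + Real.log 17161 - Real.log 13388457957161 := by
    unfold t₇
    rw [Real.log_div (by norm_num) (by norm_num), show (8580500000000 : ℝ) = 25000 * 20000 * 17161 by norm_num,
      Real.log_mul (by norm_num) (by norm_num), Real.log_mul (by norm_num) (by norm_num)]
  have l7' : Real.log (1 - t₇) = Real.log 12099 + Real.log 12101 + Real.log 32839 - Real.log 13388457957161 := by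
    unfold t₇
    rw [show (1 : ℝ) - 8580500000000 / 13388457957161 = 12099 * 12101 * 32839 / 13388457957161 by norm_num,
      Real.log_div (by norm_num) (by norm_num), Real.log_mul (by norm_num) (by norm_num),
      Real.log_mul (by norm_num) (by norm_num)]
  unfold growthSup
  rw [l1, l1', l2, l2', l3, l3', l4, l4', l5, l5', l6, l6', l7, l7']
  obtain ⟨a1, a2⟩ := log_12433_bounds
  obtain ⟨b1, b2⟩ := log_20000_bounds
  obtain ⟨c1, c2⟩ := log_7567_bounds
  obtain ⟨d1, d2⟩ := log_12901_bounds
  obtain ⟨e1, e2⟩ := log_25000_bounds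
  obtain ⟨f1, f2⟩ := log_12099_bounds
  obtain ⟨g1, g2⟩ := log_7899_bounds
  obtain ⟨i1, i2⟩ := log_12101_bounds
  obtain ⟨j1, j2⟩ := log_6753_bounds
  obtain ⟨k1, k2⟩ := log_10000_bounds
  obtain ⟨m1, m2⟩ := log_3247_bounds
  obtain ⟨o1, o2⟩ := log_1917160507051_bounds
  obtain ⟨p1, p2⟩ := log_32839_bounds
  obtain ⟨q1, q2⟩ := log_50000_bounds
  obtain ⟨r1, r2⟩ := log_17161_bounds
  obtain ⟨s1, s2⟩ := log_13388457957161_bounds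
  linarith

/-! ### Rates -/

/-- Logarithms of linear functions are eventually below any linear function: `log(a·n + b) ≤ ε·n` for large `n`. -/
theorem eventually_log_linear_le {a b ε : ℝ} (ha : 0 < a) (hb : 0 ≤ b) (hε : 0 < ε) :
    ∀ᶠ n : ℕ in atTop, Real.log (a * n + b) ≤ ε * n := by
  have h1 : Tendsto (fun n : ℕ => a * (n : ℝ) + b) atTop atTop :=
    tendsto_atTop_add_const_right _ b (tendsto_natCast_atTop_atTop.const_mul_atTop ha)
  have h2 := Real.isLittleO_log_id_atTop.bound (show (0 : ℝ) < ε / (2 * a) by positivity)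
  filter_upwards [h1.eventually h2, tendsto_natCast_atTop_atTop.eventually_ge_atTop (b / a)] with n hn hn'
  have hpos : 0 ≤ a * (n : ℝ) + b := by positivity
  rw [Real.norm_eq_abs, id, Real.norm_eq_abs, abs_of_nonneg hpos] at hn
  have hb' : b ≤ a * n := by rwa [div_le_iff₀ ha, mul_comm] at hn'
  calc Real.log (a * n + b) ≤ |Real.log (a * n + b)| := le_abs_self _
    _ ≤ ε / (2 * a) * (a * n + b) := hn
    _ ≤ ε / (2 * a) * (a * n + a * n) := by gcongr
    _ = ε * n := by field_simp; ring

/-- **Upper rate**: `∀ ε > 0`, `|Q(a·n)| ≤ e^{(85.08768884 + ε)n}` for all large `n`. -/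
theorem eventually_abs_recordQ_le_exp {ε : ℝ} (hε : 0 < ε) :
    ∀ᶠ n : ℕ in atTop, |(recordQ n : ℝ)| ≤ Real.exp ((8508768884 / 10 ^ 8 + ε) * n) := by
  filter_upwards [eventually_log_linear_le (a := 15) (b := 1) (by norm_num) (by norm_num) (half_pos hε),
    eventually_log_linear_le (a := 8) (b := 1) (by norm_num) (by norm_num) (half_pos hε)] with n h15 h8
  refine (abs_recordQ_le n).trans ?_
  have hA := growthSup_le
  have hn : (0 : ℝ) ≤ n := Nat.cast_nonneg n
  rw [← Real.exp_log (show (0 : ℝ) < 15 * n + 1 by positivity), ← Real.exp_log (show (0 : ℝ) < 8 * n + 1 by positivity),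
    ← Real.exp_add, ← Real.exp_add]
  apply Real.exp_le_exp.mpr
  nlinarith

/-- **Lower rate**: `∀ ε > 0`, `e^{(85.0519 − ε)n} ≤ |Q(a·n)|` for all large `n`. -/
theorem eventually_exp_le_abs_recordQ {ε : ℝ} (hε : 0 < ε) :
    ∀ᶠ n : ℕ in atTop, Real.exp ((850519 / 10 ^ 4 - ε) * n) ≤ |(recordQ n : ℝ)| := by
  filter_upwards [eventually_log_linear_le (a := 30) (b := 0) (by norm_num) le_rfl (show (0 : ℝ) < ε / 7 by positivity),
    eventually_ge_atTop 1, tendsto_natCast_atTop_atTop.eventually_ge_atTop (28 / ε)] with n h30 hn1 hn2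
  have hlow := abs_recordQ_ge hn1
  have hE := growthEnt_ge
  have hn : (0 : ℝ) ≤ n := Nat.cast_nonneg n
  rw [add_zero] at h30
  have h14 : (14 : ℝ) ≤ ε / 2 * n := by
    rw [div_le_iff₀ hε] at hn2; nlinarith
  rw [← Real.exp_log (abs_recordQ_pos n)]
  apply Real.exp_le_exp.mpr
  nlinarith

/-- **Any limit of `log|Q(a·n)|/n` lies in `[85.0519, 85.08768884]`** (no hypothesis; compare the FACT
`BrownZudilin2022.record_rates`, which asserts a limit in `(85.08768883, 85.08768884)`). -/
theorem rate_mem_of_tendsto {c : ℝ} (h : Tendsto (fun n : ℕ => Real.log |(recordQ n : ℝ)| / n) atTop (𝓝 c)) :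
    (850519 / 10 ^ 4 : ℝ) ≤ c ∧ c ≤ 8508768884 / 10 ^ 8 := by
  constructor
  · refine le_of_forall_pos_le_add fun ε hε => ?_
    have hev : ∀ᶠ n : ℕ in atTop, (850519 / 10 ^ 4 : ℝ) - ε ≤ Real.log |(recordQ n : ℝ)| / n := by
      filter_upwards [eventually_exp_le_abs_recordQ hε, eventually_ge_atTop 1] with n hn hn1
      have hnpos : (0 : ℝ) < n := by exact_mod_cast hn1
      rw [le_div_iff₀ hnpos]
      have := Real.log_le_log (Real.exp_pos _) hn
      rwa [Real.log_exp] at this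
    have := ge_of_tendsto h hev
    linarith
  · refine le_of_forall_pos_le_add fun ε hε => ?_
    have hev : ∀ᶠ n : ℕ in atTop, Real.log |(recordQ n : ℝ)| / n ≤ 8508768884 / 10 ^ 8 + ε := by
      filter_upwards [eventually_abs_recordQ_le_exp hε, eventually_ge_atTop 1] with n hn hn1
      have hnpos : (0 : ℝ) < n := by exact_mod_cast hn1
      rw [div_le_iff₀ hnpos]
      have := Real.log_le_log (abs_recordQ_pos n) hn
      rwa [Real.log_exp] at this
    exact le_of_tendsto h hev

/-- **The Q-half of the fact `record_rates`, upper end**: the limit `c` it asserts satisfies `c ≤ 85.08768884`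
unconditionally in its existence — i.e. given ANY limit of `log|Q(a·n)|/n`, the printed upper bracket holds. -/
theorem record_rates_Q_upper (h : Literature.NumberTheory.Irrationality.BrownZudilin2022.record_rates) :
    ∃ c : ℝ, Tendsto (fun n : ℕ => Real.log |(recordQ n : ℝ)| / n) atTop (𝓝 c)
      ∧ (850519 / 10 ^ 4 : ℝ) ≤ c ∧ c ≤ 8508768884 / 10 ^ 8 := by
  obtain ⟨-, c, -, hc⟩ := h
  exact ⟨c, hc, rate_mem_of_tendsto hc⟩

end Summit.KontsevichZagierPeriods.Zeta5Search.RecordRay
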